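import Summits.ValiantsHypothesis.ValiantsHypothesis.Theorems.KPlusLogSqLawTropicalSymmetricThreeFourFifteenLemmas

/-!
# Route «KPlusLogSqLaw» — the SYMMETRIC `(3,4)` tropical row — exclusion lemma V2 and the WINDOW behind `T_sym(3,4) ≤ 15`
# (abstract, over terms of `S₃ × (Fin 3 → Fin 4)` with the pairwise exchange hypotheses and increasing slopes)

HONEST FRAMING.  Helper file (seat val-sym-lift-p2 (g6), cell `pub-symmetroid`, 2026-08-27; `--supports` the `WeakLifting` item
stmt-ValiantsHypothesis-19561 as a helper, no closure claim).  A SMALL-FORMAT statement in the single-term-carrier model, far inside the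
known regime of the cruxes; nothing here is about `TropicalB` / `WeakLifting` in their windows, Conjecture B, the real census numeral of
Door A at `(3,4)` (`PosRootLawAt 3 4 18`, OPEN, never asserted), `MatrixDescartes` (stmt-ValiantsHypothesis-18050) or VP ≠ VNP.

THIS FILE.
* `lemmaV2`: `{0,0,3}, {0,2,3}, {1,1,2}, {1,2,2}` are not all carried (given `2·g 2 < g 0 + g 3`, which `lemmaY2` derives from `{0,2,3},
  {1,2,2}`): the crossing terms carrying `{1,2,2}` and `{1,1,2}` fix the `2`-entry resp. the `3`-entry of the `{0,2,3}` term, and then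
  `{0,0,3}` fits neither as an identity term (comparability + cancellation against `{1,2,2}`) nor as a crossing term (it would fix the same
  `3`-entry as `{1,1,2}`, and fixed-entry / pair monotonicity fails).  With its mirror V1 (via `…FifteenMirror`), X1/X2/Y1/Y2 (p484117) and
  W1/W2 (`…FifteenLemmas`) these are ALL inclusion-minimal collections of ≤ 4 rank multisets that no symmetric single-term chain carries
  (seat enumeration over the 80 generic exponent order types).
* `window`: with slopes strictly increasing along the chain, `2·g 1 < g 0 + g 2`, `2·g 2 < g 0 + g 3` (`g` = exponents by rank, monotone)
  and `{0,0,3}`, `{0,1,3}` NOT carried, the terms carrying `{0,1,2}, {1,1,2}, {0,2,2}, {1,2,2}` sit at four CONSECUTIVE positions, in this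
  order (of the twenty rank multisets only `{1,1,2}, {0,2,2}, {0,0,3}, {0,1,3}` have slope strictly between those of `{0,1,2}` and `{1,2,2}`).
[cell statement R1668 «Lemma Z»; folklore-level exchange arguments and slope bookkeeping, no citation exists]
-/

set_option linter.dupNamespace false
set_option autoImplicit false

namespace Summit.ValiantsHypothesis.ValiantsHypothesis.Theorems.KPlusLogSqLaw

open Summit.ValiantsHypothesis.ValiantsHypothesis.Theorems.MatrixDescartes.Negative
open Summit.ValiantsHypothesis.ValiantsHypothesis.Theorems.LacunarySymmetroidMatrixDescartes
open Summit.ValiantsHypothesis.ValiantsHypothesis.Theorems.LacunarySymmetroidMatrixDescartes.TropicalCensus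
open Finset

namespace SymmetricThreeFourFifteen

open SymmetricThreeFour SymmetricThreeFourSeventeen SymmetricThreeFourSixteen

/-! ## Lemma V2 -/

/-- two non-identity permutations of `Fin 3` with a common fixed point coincide. -/
theorem perm_three_eq_of_fixed : ∀ σ τ : Equiv.Perm (Fin 3), σ ≠ 1 → τ ≠ 1 → ∀ k, σ k = k → τ k = k → σ = τ := by decide

/-- **Lemma V2**: `{0,0,3}, {0,2,3}, {1,1,2}, {1,2,2}` are not all carried, given `2·g 2 < g 0 + g 3` (which `lemmaY2` derives from
`{0,2,3}, {1,2,2}`).  The crossing terms carrying `{1,2,2}` and `{1,1,2}` fix the `2`-entry resp. the `3`-entry of the `{0,2,3}` term; then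
`{0,0,3}` can be neither an identity term (comparability and the cancellation against `{1,2,2}`) nor a crossing term (it would fix the same
`3`-entry as `{1,1,2}`, and fixed-entry monotonicity fails). [exchange argument] -/
theorem lemmaV2 {n : ℕ} (r : Fin (n + 1) → Equiv.Perm (Fin 3) × (Fin 3 → Fin 4)) (g : Fin 4 → ℕ)
    (h1 : ∀ k i, (r k).2 ((r k).1 i) = (r k).2 i)
    (h2 : ∀ a b : Fin (n + 1), a < b → ∀ i, (r a).1 i = (r b).1 i → (r a).2 i ≤ (r b).2 i)
    (h6 : ∀ a b : Fin (n + 1), a < b → (r a).1 = 1 → ∀ i j : Fin 3, i ≠ j → (r b).1 i = j → (r b).1 j = i →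
      g ((r a).2 i) + g ((r a).2 j) < 2 * g ((r b).2 i))
    (h7 : ∀ a b : Fin (n + 1), a < b → (r b).1 = 1 → ∀ i j : Fin 3, i ≠ j → (r a).1 i = j → (r a).1 j = i →
      2 * g ((r a).2 i) < g ((r b).2 i) + g ((r b).2 j))
    (h8 : ∀ (a b : Fin (n + 1)) (i j : Fin 3), (r a).2 i ≤ (r b).2 j → g ((r a).2 i) ≤ g ((r b).2 j))
    (hg : 2 * g 2 < g 0 + g 3) : ∀ z b h e : Fin (n + 1),
    TropicalCensus.classSym (r z) = TropicalCensus.classSym ((1 : Equiv.Perm (Fin 3)), (![0, 0, 3] : Fin 3 → Fin 4)) →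
    TropicalCensus.classSym (r b) = TropicalCensus.classSym ((1 : Equiv.Perm (Fin 3)), (![0, 2, 3] : Fin 3 → Fin 4)) →
    TropicalCensus.classSym (r h) = TropicalCensus.classSym ((1 : Equiv.Perm (Fin 3)), (![1, 1, 2] : Fin 3 → Fin 4)) →
    TropicalCensus.classSym (r e) = TropicalCensus.classSym ((1 : Equiv.Perm (Fin 3)), (![1, 2, 2] : Fin 3 → Fin 4)) → False := by
  intro z b h e hz hb hh he
  have cz : ∀ l, (univ.filter fun i => (r z).2 i = l).card = (![2, 0, 0, 1] : Fin 4 → ℕ) l :=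
    fun l => (card_filter_eq_of_classSym_eq hz l).trans (cnt003 l)
  have cb : ∀ l, (univ.filter fun i => (r b).2 i = l).card = (![1, 0, 1, 1] : Fin 4 → ℕ) l :=
    fun l => (card_filter_eq_of_classSym_eq hb l).trans (cnt023 l)
  have ch : ∀ l, (univ.filter fun i => (r h).2 i = l).card = (![0, 2, 1, 0] : Fin 4 → ℕ) l :=
    fun l => (card_filter_eq_of_classSym_eq hh l).trans (cnt112 l)
  have ce : ∀ l, (univ.filter fun i => (r e).2 i = l).card = (![0, 1, 2, 0] : Fin 4 → ℕ) l :=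
    fun l => (card_filter_eq_of_classSym_eq he l).trans (cnt122 l)
  -- the `{0,2,3}` term is an identity term `D(w)`
  have hb1 : (r b).1 = 1 := perm_eq_one_of_card_le_one _ (h1 b) fun l => by
    rw [cb l]; fin_cases l <;> decide
  obtain ⟨k0, hk0⟩ := exists_of_card_pos ((r b).2) 0 (by rw [cb 0]; decide)
  obtain ⟨k3, hk3⟩ := exists_of_card_pos ((r b).2) 3 (by rw [cb 3]; decide)
  have wb1 : ∀ i, (r b).2 i ≠ 1 := ne_of_card_zero _ 1 (by rw [cb 1]; rfl)
  -- the `{1,1,2}` term is a crossing term: fixed entry `β` of class `2`, swapped pair of class `1`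
  have hbh : b ≠ h := by
    intro hq; have := cb 0; rw [hq, ch 0] at this; exact absurd this (by decide)
  have vh3 : ∀ i, (r h).2 i ≠ 3 := ne_of_card_zero _ 3 (by rw [ch 3]; rfl)
  have vh0 : ∀ i, (r h).2 i ≠ 0 := ne_of_card_zero _ 0 (by rw [ch 0]; rfl)
  have hh1 : (r h).1 ≠ 1 := by
    intro hq
    rcases lt_or_gt_of_ne hbh with hlt | hlt
    · have hle := h2 b h hlt k3 (by rw [hb1, hq])
      rw [hk3] at hle
      exact vh3 k3 (le_antisymm (Fin.le_last _) hle)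
    · have hle := h2 h b hlt k0 (by rw [hb1, hq])
      rw [hk0] at hle
      exact vh0 k0 (le_antisymm hle (Fin.zero_le _))
  obtain ⟨hmovH, hfixH, β, hβ⟩ := transposition_served (r h) 1 2 (h1 h) hh1 (by rw [ch 2]; rfl)
    (fun l hl => by rw [ch l]; fin_cases l <;> first | decide | exact absurd rfl hl)
  obtain ⟨i₁, j₁, hij₁, hi₁, hj₁, hi₁β, hj₁β⟩ := moved_pair (r h).1 β hh1 hβ
  have hhi₁ : (r h).2 i₁ = 1 := hmovH i₁ (by rw [hi₁]; exact hij₁.symm)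
  have hhβ : (r h).2 β = 2 := hfixH β hβ
  -- the `{1,2,2}` term is a crossing term: fixed entry `γ` of class `1`, swapped pair of class `2`
  have hbe : b ≠ e := by
    intro hq; have := cb 0; rw [hq, ce 0] at this; exact absurd this (by decide)
  have ve3 : ∀ i, (r e).2 i ≠ 3 := ne_of_card_zero _ 3 (by rw [ce 3]; rfl)
  have ve0 : ∀ i, (r e).2 i ≠ 0 := ne_of_card_zero _ 0 (by rw [ce 0]; rfl)
  have he1 : (r e).1 ≠ 1 := by
    intro hq
    rcases lt_or_gt_of_ne hbe with hlt | hlt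
    · have hle := h2 b e hlt k3 (by rw [hb1, hq])
      rw [hk3] at hle
      exact ve3 k3 (le_antisymm (Fin.le_last _) hle)
    · have hle := h2 e b hlt k0 (by rw [hb1, hq])
      rw [hk0] at hle
      exact ve0 k0 (le_antisymm hle (Fin.zero_le _))
  obtain ⟨hmovE, hfixE, γ, hγ⟩ := transposition_served (r e) 2 1 (h1 e) he1 (by rw [ce 1]; rfl)
    (fun l hl => by rw [ce l]; fin_cases l <;> first | decide | exact absurd rfl hl)
  obtain ⟨i₂, j₂, hij₂, hi₂, hj₂, hi₂γ, hj₂γ⟩ := moved_pair (r e).1 γ he1 hγ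
  have hei₂ : (r e).2 i₂ = 2 := hmovE i₂ (by rw [hi₂]; exact hij₂.symm)
  have hej₂ : (r e).2 j₂ = 2 := hmovE j₂ (by rw [hj₂]; exact hij₂)
  have heγ : (r e).2 γ = 1 := hfixE γ hγ
  -- `β ≠ γ`: otherwise the two crossing terms share their transposition and fixed-entry monotonicity fails
  have hhe : h ≠ e := by
    intro hq; have := ch 1; rw [hq, ce 1] at this; exact absurd this (by decide)
  have hβγ : β ≠ γ := by
    intro hq
    have hperm : (r h).1 = (r e).1 := perm_three_eq_of_fixed _ _ hh1 he1 β hβ (by rw [hq, hγ])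
    rcases lt_or_gt_of_ne hhe with hlt | hlt
    · have hle := h2 h e hlt β (by rw [hperm])
      rw [hhβ, hq, heγ] at hle
      exact absurd hle (by decide)
    · have hle := h2 e h hlt i₂ (by rw [hperm])
      rw [hei₂, hmovH i₂ (by rw [hperm, hi₂]; exact hij₂.symm)] at hle
      exact absurd hle (by decide)
  -- `{1,2,2}` precedes `D(w)` and `γ` is the `2`-entry of `w`
  have heb : e < b := by
    rcases lt_or_gt_of_ne hbe with hlt | hlt
    · exfalso
      have hle := h2 b e hlt γ (by rw [hb1, hγ, Equiv.Perm.one_apply])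
      rw [heγ] at hle
      have hwγ : (r b).2 γ = 0 := f4_f _ hle (wb1 γ)
      have hC := h6 b e hlt hb1 i₂ j₂ hij₂ hi₂ hj₂
      rw [hei₂] at hC
      have hwi : (r b).2 i₂ ≠ 0 := ne_of_card_one _ 0 (by rw [cb 0]; rfl) hwγ hi₂γ
      have hwj : (r b).2 j₂ ≠ 0 := ne_of_card_one _ 0 (by rw [cb 0]; rfl) hwγ hj₂γ
      have gi := h8 e b i₂ i₂ (by rw [hei₂]; exact f4_g _ hwi (wb1 i₂))
      have gj := h8 e b j₂ j₂ (by rw [hej₂]; exact f4_g _ hwj (wb1 j₂))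
      rw [hei₂] at gi; rw [hej₂] at gj
      omega
    · exact hlt
  have hwγ : (r b).2 γ = 2 := by
    have hle := h2 e b heb γ (by rw [hb1, hγ, Equiv.Perm.one_apply])
    rw [heγ] at hle
    rcases f4_h _ hle (wb1 γ) with hq | hq
    · exact hq
    · exfalso
      have hC := h7 e b heb hb1 i₂ j₂ hij₂ hi₂ hj₂
      rw [hei₂] at hC
      have hwi : (r b).2 i₂ ≠ 3 := ne_of_card_one _ 3 (by rw [cb 3]; rfl) hq hi₂γ
      have hwj : (r b).2 j₂ ≠ 3 := ne_of_card_one _ 3 (by rw [cb 3]; rfl) hq hj₂γ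
      have gi := h8 b e i₂ i₂ (by rw [hei₂]; exact f4_i _ hwi)
      have gj := h8 b e j₂ j₂ (by rw [hej₂]; exact f4_i _ hwj)
      rw [hei₂] at gi; rw [hej₂] at gj
      omega
  -- `{1,1,2}` precedes `D(w)` and `β` is the `3`-entry of `w`
  have hwβ2 : (r b).2 β ≠ 2 := ne_of_card_one _ 2 (by rw [cb 2]; rfl) hwγ hβγ
  have hhb : h < b := by
    rcases lt_or_gt_of_ne hbh with hlt | hlt
    · exfalso
      have hle := h2 b h hlt β (by rw [hb1, hβ, Equiv.Perm.one_apply])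
      rw [hhβ] at hle
      have hwβ : (r b).2 β = 0 := by
        rcases f4_a _ hwβ2 hle with hq | hq
        · exact hq
        · exact absurd hq (wb1 β)
      have hC := h6 b h hlt hb1 i₁ j₁ hij₁ hi₁ hj₁
      rw [hhi₁] at hC
      have hwi : (r b).2 i₁ ≠ 0 := ne_of_card_one _ 0 (by rw [cb 0]; rfl) hwβ hi₁β
      have hwj : (r b).2 j₁ ≠ 0 := ne_of_card_one _ 0 (by rw [cb 0]; rfl) hwβ hj₁β
      have gi := h8 h b i₁ i₁ (by rw [hhi₁]; exact f4_b _ hwi)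
      have gj := h8 h b j₁ j₁ (by rw [hmovH j₁ (by rw [hj₁]; exact hij₁)]; exact f4_b _ hwj)
      rw [hhi₁] at gi; rw [hmovH j₁ (by rw [hj₁]; exact hij₁)] at gj
      omega
    · exact hlt
  have hwβ : (r b).2 β = 3 := by
    have hle := h2 h b hhb β (by rw [hb1, hβ, Equiv.Perm.one_apply])
    rw [hhβ] at hle
    exact f4_d _ hle hwβ2
  -- the `{0,0,3}` term
  have hzb : z ≠ b := by
    intro hq; have := cz 0; rw [hq, cb 0] at this; exact absurd this (by decide)
  have hze : z ≠ e := by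
    intro hq; have := cz 0; rw [hq, ce 0] at this; exact absurd this (by decide)
  have hzh : z ≠ h := by
    intro hq; have := cz 0; rw [hq, ch 0] at this; exact absurd this (by decide)
  have yz1 : ∀ i, (r z).2 i ≠ 1 := ne_of_card_zero _ 1 (by rw [cz 1]; rfl)
  have yz2 : ∀ i, (r z).2 i ≠ 2 := ne_of_card_zero _ 2 (by rw [cz 2]; rfl)
  by_cases hz1 : (r z).1 = 1
  · -- `{0,0,3} = D(y)`: `y ≤ w` entrywise, and the cancellation against `{1,2,2}` reads `g 0 + g 3 < 2 g 2`
    have hzb' : z < b := by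
      rcases lt_or_gt_of_ne hzb with hlt | hlt
      · exact hlt
      · exfalso
        have hγ3 : (r z).2 γ = 3 := by
          have hle := h2 b z hlt γ (by rw [hb1, hz1])
          rw [hwγ] at hle
          exact f4_d _ hle (yz2 γ)
        have hβ3 : (r z).2 β = 3 := by
          have hle := h2 b z hlt β (by rw [hb1, hz1])
          rw [hwβ] at hle
          exact le_antisymm (Fin.le_last _) hle
        have h2le := two_le_card_filter (r z) hβγ (hβ3.trans hγ3.symm)
        rw [hγ3, cz 3] at h2le
        exact absurd h2le (by decide)
    have hyγ : (r z).2 γ ≠ 3 := by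
      intro hq
      have hle := h2 z b hzb' γ (by rw [hb1, hz1])
      rw [hq, hwγ] at hle
      exact absurd hle (by decide)
    rcases lt_or_gt_of_ne hze with hlt | hlt
    · have hC := h6 z e hlt hz1 i₂ j₂ hij₂ hi₂ hj₂
      rw [hei₂] at hC
      -- the `3` of `y` is on the swapped pair `{i₂, j₂}` (not at `γ`), the other swapped entry carries `0`
      obtain ⟨q3, hq3⟩ := exists_of_card_pos ((r z).2) 3 (by rw [cz 3]; decide)
      have hq3γ : q3 ≠ γ := by rintro rfl; exact hyγ hq3
      have hy0 : ∀ i, i ≠ q3 → (r z).2 i = 0 := fun i hi =>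
        f4_f _ (f4_e _ (ne_of_card_one _ 3 (by rw [cz 3]; rfl) hq3 hi) (yz2 i)) (yz1 i)
      rcases eq_or_eq_of_ne_third i₂ j₂ γ q3 hij₂ hi₂γ hj₂γ hq3γ with hq | hq
      · rw [hq] at hq3
        rw [hq3, hy0 j₂ (fun h' => hij₂ (h'.trans hq).symm)] at hC
        omega
      · rw [hq] at hq3
        rw [hq3, hy0 i₂ (fun h' => hij₂ (h'.trans hq))] at hC
        omega
    · have hle := h2 e z hlt γ (by rw [hz1, hγ, Equiv.Perm.one_apply])
      rw [heγ] at hle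
      rcases f4_c _ (yz1 γ) (yz2 γ) with hq | hq
      · rw [hq] at hle; exact absurd hle (by decide)
      · exact hyγ hq
  · -- `{0,0,3}` is a crossing term with fixed class `3`: it fixes `β` as `{1,1,2}` does, and monotonicity at `β` or on the pair fails
    obtain ⟨hmovZ, hfixZ, α, hα⟩ := transposition_served (r z) 0 3 (h1 z) hz1 (by rw [cz 3]; rfl)
      (fun l hl => by rw [cz l]; fin_cases l <;> first | decide | exact absurd rfl hl)
    obtain ⟨i₃, j₃, hij₃, hi₃, hj₃, -, -⟩ := moved_pair (r z).1 α hz1 hα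
    have hzi₃ : (r z).2 i₃ = 0 := hmovZ i₃ (by rw [hi₃]; exact hij₃.symm)
    have hzα : (r z).2 α = 3 := hfixZ α hα
    have hzb' : z < b := by
      rcases lt_or_gt_of_ne hzb with hlt | hlt
      · exact hlt
      · exfalso
        have hC := h6 b z hlt hb1 i₃ j₃ hij₃ hi₃ hj₃
        rw [hzi₃] at hC
        have gi := h8 z b i₃ i₃ (by rw [hzi₃]; exact Fin.zero_le _)
        have gj := h8 z b i₃ j₃ (by rw [hzi₃]; exact Fin.zero_le _)
        rw [hzi₃] at gi gj
        omega
    have hαβ : α = β := by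
      by_contra hq
      have hle := h2 z b hzb' α (by rw [hb1, hα, Equiv.Perm.one_apply])
      rw [hzα] at hle
      exact ne_of_card_one _ 3 (by rw [cb 3]; rfl) hwβ hq (le_antisymm (Fin.le_last _) hle)
    have hperm : (r z).1 = (r h).1 := perm_three_eq_of_fixed _ _ hz1 hh1 β (by rw [← hαβ, hα]) hβ
    rcases lt_or_gt_of_ne hzh with hlt | hlt
    · have hle := h2 z h hlt β (by rw [hperm])
      rw [← hαβ, hzα, hαβ, hhβ] at hle
      exact absurd hle (by decide)
    · have hle := h2 h z hlt i₁ (by rw [hperm])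
      rw [hhi₁, hmovZ i₁ (by rw [hperm, hi₁]; exact hij₁.symm)] at hle
      exact absurd hle (by decide)


/-! ## The window: the four terms are consecutive -/

/-- the four elements of `Fin 4`. -/
theorem f4_cases : ∀ x : Fin 4, x = 0 ∨ x = 1 ∨ x = 2 ∨ x = 3 := by decide

/-- terms with the same class map have the same class multiset. -/
theorem classSym_eq_of_snd_eq {p q : Equiv.Perm (Fin 3) × (Fin 3 → Fin 4)} (h : p.2 = q.2) :
    TropicalCensus.classSym p = TropicalCensus.classSym q := by
  unfold TropicalCensus.classSym
  simp only [h]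

/-- terms with the same class multiset have the same slope. -/
theorem slope_eq_of_classSym_eq' (g : Fin 4 → ℕ) {p q : Equiv.Perm (Fin 3) × (Fin 3 → Fin 4)}
    (h : TropicalCensus.classSym p = TropicalCensus.classSym q) : TropicalCensus.slope g p = TropicalCensus.slope g q := by
  rw [slope_eq_of_classSym, slope_eq_of_classSym, h]

/-- the slope of an explicit identity pattern. -/
theorem slope_one_vec (g : Fin 4 → ℕ) (x y z : Fin 4) :
    TropicalCensus.slope g ((1 : Equiv.Perm (Fin 3)), (![x, y, z] : Fin 3 → Fin 4)) = (g x : ℤ) + g y + g z := by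
  unfold TropicalCensus.slope
  rw [Fin.sum_univ_three]
  rfl

/-- **The window.**  With slopes strictly increasing along the chain, `2·g 1 < g 0 + g 2`, `2·g 2 < g 0 + g 3`, `g` monotone, and
`{0,0,3}`, `{0,1,3}` NOT carried, the terms carrying `{0,1,2}, {1,1,2}, {0,2,2}, {1,2,2}` occupy four consecutive positions, in this order.
[slope bookkeeping: of the twenty rank multisets only `{1,1,2}, {0,2,2}, {0,0,3}, {0,1,3}` have slope strictly between those of `{0,1,2}` and
`{1,2,2}`] -/
theorem window {n : ℕ} (r : Fin (n + 1) → Equiv.Perm (Fin 3) × (Fin 3 → Fin 4)) (g : Fin 4 → ℕ) (hmono : Monotone g)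
    (h3 : Function.Injective fun k => TropicalCensus.classSym (r k))
    (hS : ∀ a b : Fin (n + 1), a < b → TropicalCensus.slope g (r a) < TropicalCensus.slope g (r b))
    (hg12 : 2 * g 1 < g 0 + g 2) (hg23 : 2 * g 2 < g 0 + g 3) (a₀ c f e : Fin (n + 1))
    (ha : TropicalCensus.classSym (r a₀) = TropicalCensus.classSym ((1 : Equiv.Perm (Fin 3)), (![0, 1, 2] : Fin 3 → Fin 4)))
    (hc : TropicalCensus.classSym (r c) = TropicalCensus.classSym ((1 : Equiv.Perm (Fin 3)), (![1, 1, 2] : Fin 3 → Fin 4)))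
    (hf : TropicalCensus.classSym (r f) = TropicalCensus.classSym ((1 : Equiv.Perm (Fin 3)), (![0, 2, 2] : Fin 3 → Fin 4)))
    (he : TropicalCensus.classSym (r e) = TropicalCensus.classSym ((1 : Equiv.Perm (Fin 3)), (![1, 2, 2] : Fin 3 → Fin 4)))
    (hno003 : ∀ k, TropicalCensus.classSym (r k) ≠ TropicalCensus.classSym ((1 : Equiv.Perm (Fin 3)), (![0, 0, 3] : Fin 3 → Fin 4)))
    (hno013 : ∀ k, TropicalCensus.classSym (r k) ≠ TropicalCensus.classSym ((1 : Equiv.Perm (Fin 3)), (![0, 1, 3] : Fin 3 → Fin 4))) :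
    (c : ℕ) = a₀ + 1 ∧ (f : ℕ) = a₀ + 2 ∧ (e : ℕ) = a₀ + 3 := by
  have g01 : g 0 ≤ g 1 := hmono (by decide)
  have g12 : g 1 ≤ g 2 := hmono (by decide)
  have g23 : g 2 ≤ g 3 := hmono (by decide)
  have sa : TropicalCensus.slope g (r a₀) = (g 0 : ℤ) + g 1 + g 2 := (slope_eq_of_classSym_eq' g ha).trans (slope_one_vec g 0 1 2)
  have sc : TropicalCensus.slope g (r c) = (g 1 : ℤ) + g 1 + g 2 := (slope_eq_of_classSym_eq' g hc).trans (slope_one_vec g 1 1 2)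
  have sf : TropicalCensus.slope g (r f) = (g 0 : ℤ) + g 2 + g 2 := (slope_eq_of_classSym_eq' g hf).trans (slope_one_vec g 0 2 2)
  have se : TropicalCensus.slope g (r e) = (g 1 : ℤ) + g 2 + g 2 := (slope_eq_of_classSym_eq' g he).trans (slope_one_vec g 1 2 2)
  -- order of the four terms
  have hlt_of : ∀ x y : Fin (n + 1), x ≠ y → ¬ (TropicalCensus.slope g (r y) < TropicalCensus.slope g (r x)) → x < y := by
    intro x y hne hnot
    rcases lt_or_gt_of_ne hne with h | h
    · exact h
    · exact absurd (hS y x h) hnot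
  have hac : a₀ < c := hlt_of a₀ c (fun h => by rw [h] at ha; exact absurd (counts_eq_of_classSym_eq (ha.symm.trans hc)) (by decide))
    (by rw [sa, sc]; omega)
  have hcf : c < f := hlt_of c f (fun h => by rw [h] at hc; exact absurd (counts_eq_of_classSym_eq (hc.symm.trans hf)) (by decide))
    (by rw [sc, sf]; omega)
  have hfe : f < e := hlt_of f e (fun h => by rw [h] at hf; exact absurd (counts_eq_of_classSym_eq (hf.symm.trans he)) (by decide))
    (by rw [sf, se]; omega)
  -- any term strictly between `a₀` and `e` is `c` or `f`
  have key : ∀ j : Fin (n + 1), a₀ < j → j < e → j = c ∨ j = f := by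
    intro j h1j hje
    have hlo := hS a₀ j h1j
    have hhi := hS j e hje
    rw [sa] at hlo; rw [se] at hhi
    obtain ⟨x0, hx0⟩ : ∃ x, (r j).2 0 = x := ⟨_, rfl⟩
    obtain ⟨x1, hx1⟩ : ∃ x, (r j).2 1 = x := ⟨_, rfl⟩
    obtain ⟨x2, hx2⟩ : ∃ x, (r j).2 2 = x := ⟨_, rfl⟩
    have hfun : (r j).2 = ![x0, x1, x2] := by
      funext i; fin_cases i
      · exact hx0
      · exact hx1
      · exact hx2
    have hcs : TropicalCensus.classSym (r j) = TropicalCensus.classSym ((1 : Equiv.Perm (Fin 3)), (![x0, x1, x2] : Fin 3 → Fin 4)) :=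
      classSym_eq_of_snd_eq hfun
    have hsj : TropicalCensus.slope g (r j) = (g x0 : ℤ) + g x1 + g x2 := (slope_eq_of_classSym_eq' g hcs).trans (slope_one_vec g x0 x1 x2)
    rw [hsj] at hlo hhi
    have h003 := hno003 j
    have h013 := hno013 j
    rw [hcs] at h003 h013
    have hjc : TropicalCensus.classSym ((1 : Equiv.Perm (Fin 3)), (![x0, x1, x2] : Fin 3 → Fin 4)) =
        TropicalCensus.classSym ((1 : Equiv.Perm (Fin 3)), (![1, 1, 2] : Fin 3 → Fin 4)) → j = c ∨ j = f :=
      fun h => Or.inl (h3 ((hcs.trans h).trans hc.symm))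
    have hjf : TropicalCensus.classSym ((1 : Equiv.Perm (Fin 3)), (![x0, x1, x2] : Fin 3 → Fin 4)) =
        TropicalCensus.classSym ((1 : Equiv.Perm (Fin 3)), (![0, 2, 2] : Fin 3 → Fin 4)) → j = c ∨ j = f :=
      fun h => Or.inr (h3 ((hcs.trans h).trans hf.symm))
    rcases f4_cases x0 with rfl | rfl | rfl | rfl <;> rcases f4_cases x1 with rfl | rfl | rfl | rfl <;>
      rcases f4_cases x2 with rfl | rfl | rfl | rfl <;>
      first
        | (exfalso; omega)
        | exact absurd (by decide) h003
        | exact absurd (by decide) h013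
        | exact hjc (by decide)
        | exact hjf (by decide)
  -- counting inside the window
  have hc' := hac; have hf' := hcf; have he' := hfe
  rw [Fin.lt_def] at hc' hf' he'
  have hen : (e : ℕ) < n + 1 := e.isLt
  have k1 := key ⟨(a₀ : ℕ) + 1, by omega⟩ (by rw [Fin.lt_def]; simp) (by rw [Fin.lt_def]; simp only; omega)
  have k2 := key ⟨(a₀ : ℕ) + 2, by omega⟩ (by rw [Fin.lt_def]; simp) (by rw [Fin.lt_def]; simp only; omega)
  simp only [Fin.ext_iff] at k1 k2
  by_cases h4 : (a₀ : ℕ) + 4 ≤ e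
  · have k3 := key ⟨(a₀ : ℕ) + 3, by omega⟩ (by rw [Fin.lt_def]; simp) (by rw [Fin.lt_def]; simp only; omega)
    simp only [Fin.ext_iff] at k3
    omega
  · omega

end SymmetricThreeFourFifteen

end Summit.ValiantsHypothesis.ValiantsHypothesis.Theorems.KPlusLogSqLaw
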